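import Summits.Ventures.PercRepro.S1TriangleCount

/-!
# PercRepro — the flat bounds (C1), (C2), (C3) survive deleting a point (p1, gen 20; the s₄ recursion's transport)

Axioms: standard.
-/

open scoped Matroid

namespace PercRepro

namespace S1

open Set

variable {α : Type}

/-- A bound «every set of rank `≤ k` has `≤ m` points» survives deleting a point. -/
theorem flat_bound_le_delete (M : Matroid α) {k : ℕ∞} {m : ℕ}
    (hC : ∀ P ⊆ M.E, M.eRk P ≤ k → P.ncard ≤ m) (e : α) :
    ∀ P ⊆ (M ＼ {e}).E, (M ＼ {e}).eRk P ≤ k → P.ncard ≤ m := by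
  intro P hP hr
  rw [_root_.Matroid.delete_ground] at hP
  rw [delete_singleton_eRk_eq hP] at hr
  exact hC P (hP.trans sdiff_subset) hr

/-- A bound «every set of rank `= k` has `≤ m` points» survives deleting a point. -/
theorem flat_bound_eq_delete (M : Matroid α) {k : ℕ∞} {m : ℕ}
    (hC : ∀ P ⊆ M.E, M.eRk P = k → P.ncard ≤ m) (e : α) :
    ∀ P ⊆ (M ＼ {e}).E, (M ＼ {e}).eRk P = k → P.ncard ≤ m := by
  intro P hP hr
  rw [_root_.Matroid.delete_ground] at hP
  rw [delete_singleton_eRk_eq hP] at hr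
  exact hC P (hP.trans sdiff_subset) hr

end S1

end PercRepro
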